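import Literature.NumberTheory.EllipticCurves.Kim2025.CorankStructureOPEN
import Literature.NumberTheory.EllipticCurves.CyclotomicIwasawaMainTheoremIrreducible
import Literature.NumberTheory.EllipticCurves.KatoRankBoundProofs
import Literature.NumberTheory.EllipticCurves.SkinnerUrban2014.CharacteristicIdealBaseChangeProofs
import Literature.NumberTheory.EllipticCurves.SkinnerUrban2014.ShaOrderOfMainConjectureProofs
import Literature.NumberTheory.EllipticCurves.NonEisensteinPrimeOfSurjective
import HarnessLib

/-!
# Kim 2025 (arXiv:2505.09121v1, PREPRINT), Thm. 1.2 — clause (IMC at 𝟙) and its converse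
# ("`δ^{min,†}` does not vanish ⟺ the Iwasawa main identity for `T_f^†` LOCALIZED AT THE
# AUGMENTATION IDEAL"), with §3.5.3 (statement 3.17, Thm. 3.18, Thm. 3.19) — read in weight `2` for
# elliptic curves over `ℚ` at a good ORDINARY prime `p ≥ 3` under large `p`-adic image

Topic `NumberTheory/EllipticCurves`, sub-directory `Kim2025` (namespace = path). Fourth file of the
story (`LargeImageStructureOPEN`, `StructureClauseOPEN`, `CorankStructureOPEN`), written by the
cross-ladder literature-typing layer (cell `bsd-littype`, seat 09, gen 3; D-0088(4)). The two
earlier typings of this paper recorded Thm. 1.2 (IMC at 𝟙) and its converse as a GAP ("no `Λ`,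
`char_Λ` vocabulary"); meanwhile the tree carries everything needed to state them for elliptic
curves AT A GOOD ORDINARY PRIME: the height-one prime `𝔭_T = (T) ⊂ Λ = ℤ_p⟦T⟧`
(`IwasawaAlgebra.primeT`), local lengths (`Module.lengthAt`, whose value at `𝔭_T` is the exponent
of `(T)` in `Module.charIdeal`), the Pontryagin dual `X(E/ℚ_∞)` of `Sel_{p^∞}(E/ℚ_∞)` as a
`Λ`-module (`WeierstrassCurve.SelmerDualData`, `T = γ − 1`) and the Mazur–Swinnerton-Dyer `p`-adic
`L`-function `L_p(E,T) = padicLFunction f α` in the cyclotomic variable (`IsCyclotomicVariable`).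
HONEST FRAMING (cell, verbatim): "no tranche here proves BSD … typed ≠ proved ≠ endorsed". The
source is an UNREFEREED PREPRINT: every statement taken from it is a `def … : Prop` named `…_OPEN`,
tagged `[claim: Kim2025RefinedTNC, status: under-review]`; nothing is asserted. What IS proved here
is bookkeeping in the kernel: the tree's published main-conjecture statements (Skinner–Urban 2014
Thm. 3.6.9, `skinner_urban_main_conjecture`, printed for every odd `p`; Burungale–Castella–Skinner
2025 Thm. 1.1.2 (a), `burungale_castella_skinner_charIdeal_eq_padicLFunction`, `p ≥ 5`) imply the
identity at `𝟙`, so that — MODULO the preprint's Thm. 1.2 — the collection of Kurihara numbers of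
`E` does not vanish at `p = 3` for the Skinner–Urban class of curves, which the two structure
clauses of Thm. 1.1 (`thm11_…_OPEN`, sibling `CorankStructureOPEN`) then consume.

## The printed statements (held TeX-derived text `paper:arxiv-2505.09121`, chunk locators `pNNNN:Lnn`)

* **Thm. 1.2** (Main Theorem II; §1.2.2, p0005:L22–L35): "Let `f ∈ S_k(Γ₀(N))` be a newform and
  `p ≥ 3` a prime such that `ρ_f` has large image. If one of the following conditions is
  satisfied: (rk0) …, (rk1+ε) …, (IMC at 𝟙) the Iwasawa main conjecture for `T_f^†` localized at
  the augmentation ideal holds (Conjecture 3.17), or (ord) `p ≥ 5`, `f` is good ordinary at `p`,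
  and `f` is `p`-distinguished (Theorem 3.19), then `δ^{min,†}` does not vanish. Conversely, if
  `δ^{min,†}` does not vanish, then the Iwasawa main conjecture for `T_f^†` localized at the
  augmentation ideal holds. In particular, either (rk0) or (rk1+ε) implies (IMC at 𝟙)." Proof
  (p0005:L37–L42): "The equivalence between `δ^{min,†} ≠ 0` and (IMC at 𝟙) follows from Theorem
  3.18.(2) and Proposition 4.2 again. The (ord) case follows from (IMC at 𝟙) and Theorem 3.19."
  Followed by (p0005:L44): "By computing `ord_π(δ^{min,k−r}_n)` for many `n`, we can verify
  (IMC at 𝟙) numerically." and §1 (p0003:L23): "the Iwasawa main conjecture localized at the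
  augmentation ideal is strong enough to detect the exact bound of Selmer groups."
* **§3.5.1** (p0014:L9–L10): "`Λ = Λ_Iw = ℤ_p⟦Gal(ℚ_∞/ℚ)⟧`", `ℚ_∞` the cyclotomic `ℤ_p`-extension.
  **Statement 3.17** (p0014:L43–L51): "Assume that `ρ_f` has large image. For a height one prime
  `𝔓` of `Λ`, the Iwasawa main conjecture for `T_f(k−r)` localized at `𝔓` means the equality
  `ord_𝔓(char_Λ(H¹_Iw(ℚ, T_f(k−r))/Λκ^{Kato,k−r,∞}_1)) = ord_𝔓(char_Λ(Sel₀(ℚ_∞, W_{f̄}(r))^∨))`.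
  The Iwasawa main conjecture for `T_f(k−r)` means [this] localized at every height one prime
  ideal." **Thm. 3.16 (Kato)** (p0014:L26–L36): under `ρ̄_f` irreducible, "`H¹_Iw(ℚ, T_f(k−r))` is
  free of rank one over `Λ`" and "`Sel₀(ℚ_∞, W_{f̄}(r))^∨` is a finitely generated torsion
  `Λ`-module." **Thm. 3.18 (Kato, Mazur–Rubin)** (p0014:L53–L73): (1) the one-sided divisibility
  `char_Λ(H¹_Iw/Λκ₁^∞) ⊆ char_Λ(Sel₀(ℚ_∞, W)^∨)`; (2) "The specialization of `κ^{Kato,k−r,∞}` at a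
  height one prime `𝔓` of `Λ` is non-trivial if and only if the Iwasawa main conjecture for
  `T_f(k−r)` localized at `𝔓` holds"; (3) `Λ`-primitivity ⟺ the full equality; with "Although
  [mazur-rubin-book] claims one direction of the second and the third statements, the proof
  implies the equivalence." **Thm. 3.19 (Kato, Skinner–Urban, Wan)** (p0014:L75–L81): "Suppose
  that `ψ = 𝟙` and `f` is good ordinary at `p` and `p`-distinguished. (SU) If `ρ_f` has large
  image, `k ≡ 2 (mod p−1)`, and there exists a prime `ℓ` exactly dividing `N` where `ρ̄_f` is
  ramified, then [3.17 holds] for every height one prime `𝔓` of `Λ`. (Wan) If `p ≥ 5` and `ρ̄_f` is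
  irreducible, then [3.17 holds] for every height one prime `𝔓` except `πΛ`. Proof. See
  [kato-euler-systems], [skinner-urban], and [wan_hilbert]. The latter two results concern the
  Iwasawa main conjecture with `p`-adic `L`-functions, which is equivalent to Conjecture 3.17 via
  the global Poitou–Tate duality [kato-euler-systems]."
* The passage between the two formulations, prime of height one by prime of height one, is
  K. Kato, Astérisque 295 (2004), §17.13, p. 280: for every height-one `𝔭` (for `𝔭 ∋ p` under
  `p ≠ 2` and (12.5.2)) "`length(𝔛_𝔭) − length(Λ_𝔭/(L_{p-adic})) = length(𝐇²(T)_𝔭) −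
  length(𝐇¹(T)_𝔭/Z(f,T)_𝔭)` … Hence Thm. 17.4 (resp. Conj. 17.6) becomes a consequence of Thm. 12.5
  (resp. Conj. 12.10)" — at the augmentation prime `𝔭 = (γ−1) = (T) ∌ p` with NO image hypothesis.

## Dictionary (as in the three sibling files; `k = 2`, `𝒪 = ℤ_p`, `f = f_E`, `T_f^† ≅ T_pE`)

`W/ℚ` a globally minimal elliptic curve with newform `f` (`IsNewformOf W f`); LARGE IMAGE = the
full tower `ρ̄_{E,p^n}` onto for all `n`; KURIHARA NUMBERS `kuriharaNumber f (p^k) n ψ`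
(`Ω⁺_f`-normalised) with the integral-period binder "`0 ≤ ord_p [r]⁺_f` whenever `[r]⁺_f ≠ 0`"
(so `Ω⁺_f` is an integral period in the sense of Def. 2.2 and §1.4.4 applies: "Any non-minimal
integral periods can play the exactly same role in Theorems 1.1 and 1.8 without any modification";
`Ω⁺_f = Ω_min/c` with `c ∈ ℤ_p ∖ 0`, `δ̃^{Ω⁺_f}_n = c·δ^{min}_n`); "`δ^{min,†}` does not vanish"
is read, as in every Kim-type statement of the tree (flag `Kim2026-(6)-cyclic-reading`), as
`kuriharaVanishingOrder W p f < ⊤`: SOME cyclic Kolyvagin level `n` carries `δ̃_n ≠ 0` in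
`ℤ_p/I_nℤ_p` — this is where the printed proof puts the witness (§5.3.2–5.3.3, p0018:L86–p0019:L12:
`n ∈ 𝒩_m`, `m ≫ 0`, chosen "in the standard Kolyvagin system argument [mazur-rubin-book]"
(Rem. 5.5) by the Chebotarev Propositions 3.3/3.4, at primes where `H¹_f(ℚ_ℓ, E[p])` is a line,
with `ord_π(δ^{min}_n)` bounded independently of `m` ("we also have `δ^{min}_n ≠ 0` since `m ≫ 0`"),
so that `c·δ^{min}_n ≠ 0 (mod I_n)` as well). `p`-DISTINGUISHED is automatic in weight `2` at an odd
prime (`ρ̄|_{I_p}` has the ramified diagonal character `ω`). THE IDENTITY AT 𝟙 for `E` at a GOOD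
ORDINARY `p`: by the proof of Thm. 3.19 ("equivalent … via the global Poitou–Tate duality") and Kato
§17.13 at `𝔭 = (T)`, statement 3.17 for `T_pE` localized at the augmentation ideal is the equality
`length_{Λ_{(T)}} X(E/ℚ_∞)_{(T)} = ord_{(T)} L_p(E,T)`, i.e. — `(T)` not containing `p`, every
non-zero rational constant (period normalisation `ϖ`, `Ω_E = ϖ⁻¹Ω⁺_f`; powers of `p`) being a unit
of `Λ_{(T)}` — `Module.lengthAt Λ X (primeT p) = ord_{T=0}(padicLFunction f α)` for the cyclotomic
datum `(κ, γ)` normalised by `IsCyclotomicVariable p γ` (`T = γ_cyc − 1`, the variable of `L_p`):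
`mainIdentityAtAugmentation` below. For a torsion `X` with `char_Λ X = (g)` the left side is
`ord_T g` (`lengthAt_primeT_eq_order_of_charIdeal_eq_span`, proved), so the RATIONAL main conjecture
`char_Λ X·(Λ ⊗ ℚ_p) = (L_p)` already implies the identity at `𝟙`
(`mainIdentityAtAugmentation_of_charIdeal_eq_span`, proved).

## What is here / not here

One DEFINITION (`mainIdentityAtAugmentation`, a predicate with body; nothing asserted), two
`_OPEN` `Prop`s (Thm. 1.2 (IMC at 𝟙) ⟹ non-vanishing; the converse), and PROVED bookkeeping:
`lengthAt_primeT_eq_order_of_charIdeal_eq_span` (pure `Λ`-algebra), the identity at `𝟙` from the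
tree's main-conjecture shapes (`…_of_charIdeal_eq_span`, `…_of_skinnerUrban` for every odd `p`
with a multiplicative prime `ℓ` at which `E[p]` is ramified, `…_of_bcs` for `p ≥ 5`), the
resulting non-vanishing of the Kurihara numbers and its composition with the corank and structure
clauses of Thm. 1.1 (`kuriharaVanishingOrder_lt_top_of_skinnerUrban_of_OPEN`,
`selmerCorank_eq_kuriharaVanishingOrder_of_skinnerUrban_of_OPEN`,
`sha_structure_of_skinnerUrban_of_OPEN`, and the `p ≥ 5` twins), and the numerical-verification
reading of p0005:L44 (`mainIdentityAtAugmentation_of_kuriharaNumber_ne_zero_of_OPEN`: one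
non-vanishing Kurihara number at a cyclic level certifies the identity at `𝟙`). All weaker than
print (weight `2`; good ORDINARY `p` only — the identity at `𝟙` is typed through the `p`-adic
`L`-function; tower; cyclic levels; integral-period binder), never stronger. NOT typable today:
statement 3.17 / Thm. 3.18 at a non-ordinary or bad prime and Thm. 1.1 (Non-triv) — they need
Kato's zeta submodule `Z(f, T_pE) ⊂ 𝐇¹` PINNED (the tree's `Kato2004.IwasawaH1Data` and
`WeierstrassCurve.FineSelmerDualData` give both sides of 3.17, and `IwasawaH1Data.existsUnique_lift_of_zetaBody`
lifts the `a(A)`-type zeta families, but the `SL₂(ℤ)`-type generators of Kato Thm. 12.6 (2) /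
the element `𝐳_γ` of Thm. 12.5 (1) are not in the tree, so `Λκ₁^{Kato,∞}` has no name) and Kato's
Kolyvagin system `κ^{Kato}` as an element of `KS(T_pE, 𝓕_can, 𝒫)`; Thm. 3.16 (1) is the tree's
named fact `Kato2004.thm12_4` (not restated). Conjecture 3.17 itself is a conjecture (CONVENTIONS
§4: not Literature); only its localization at `𝟙` in Mazur's form is given a NAME here, as a
definition.

## References
* C.-H. Kim (appendix with R. Pollack), arXiv:2505.09121v1 (2025): §1 (p0003:L9, L23), Thm. 1.2
  and its proof (p0005:L22–L44), §1.4.4 (p0008:L43–L46), Def. 2.2 / Rem. 2.3, Prop. 4.2 (p0016:L50),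
  §3.5.1–3.5.3: Thm. 3.15, Thm. 3.16, statement 3.17, Thm. 3.18, Thm. 3.19 (p0014:L9–L81), Rem. 5.5
  and §5.3.2–5.3.3 (p0018:L86–p0019:L12). [Kim2025RefinedTNC]
* K. Kato, Astérisque 295 (2004): Thm. 12.4, Thm. 12.5, Conj. 12.10, Thm. 17.4, Conj. 17.6, §17.13
  (p. 280). [Kato2004Asterisque]
* C. Skinner, E. Urban, Invent. Math. 195 (2014), Thm. 3.6.9 (= tree `skinner_urban_main_conjecture`,
  printed for every odd `p`). [SkinnerUrban2014]
* A. Burungale, F. Castella, C. Skinner, IMRN 2025 rnaf082 = arXiv:2405.00270v2, Thm. 1.1.2 (a)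
  (= tree `burungale_castella_skinner_charIdeal_eq_padicLFunction`). [BurungaleCastellaSkinner2025]
* B. Mazur, K. Rubin, *Kolyvagin systems*, Mem. AMS 799 (2004), Thm. 5.3.10 (the printed source of
  Thm. 3.18). [MazurRubin2004]
* R. Sakamoto, J. Théor. Nombres Bordeaux 36 (2024), Thm. 1.1 (the refereed `p = 3` Chebotarev input
  of §3.2.2 / Prop. 3.4). [Sakamoto2024KolyvaginThree]
* L. C. Washington, *Introduction to Cyclotomic Fields*, §13.2 (the prime `(T)` of `Λ`,
  characteristic power series). [Washington1997]
-/

noncomputable section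

open scoped MatrixGroups ModularForm Classical

open CongruenceSubgroup Literature.NumberTheory.EllipticCurves.ModularForms
  Literature.NumberTheory.EllipticCurves Literature.NumberTheory.EllipticCurves.Module
  Literature.NumberTheory.EllipticCurves.IwasawaAlgebra

universe u

namespace Literature.NumberTheory.EllipticCurves.Kim2025

/-! ### The identity at `𝟙` (definition) -/

/-- **Kim's "(IMC at 𝟙)" for an elliptic curve at a good ordinary prime, in Mazur's form: the
multiplicity of the augmentation prime `(T) = (γ − 1)` in `char_Λ X(E/ℚ_∞)` equals the order of
vanishing of `L_p(E,T)` at `T = 0`.** For the Pontryagin-dual datum `D` of `Sel_{p^∞}(E/ℚ_∞)`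
(`Λ = ℤ_p⟦T⟧`, `T = γ − 1`) and a newform `f` (of `W`, in every use):
`length_{Λ_{(T)}} (D.X)_{(T)} = ord_{T=0} padicLFunction f α`, `α = unitRoot W p`, both in `ℕ∞`.
This is statement 3.17 of the source for `T_f^† = T_pE` LOCALIZED AT THE AUGMENTATION IDEAL, read
through the source's own sentence "the Iwasawa main [identity] with `p`-adic `L`-functions … is
equivalent to [3.17] via the global Poitou–Tate duality" (proof of Thm. 3.19) and Kato 2004 §17.13
(p. 280) at the height-one prime `𝔭 = (T)`, which does not contain `p` (so no image hypothesis
enters and the period normalisation and powers of `p` are units of `Λ_𝔭`); meaningful for the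
cyclotomic `κ` with `κ.IsTopGenerator γ`, `IsCyclotomicVariable p γ` and `p` good ordinary. A
PREDICATE (definition with body); nothing is asserted.
[cite: Kim2025RefinedTNC, Thm. 1.2 clause (IMC at 𝟙) (§1.2.2, chunk p0005:L30), statement 3.17 (§3.5.3, chunk p0014:L43–L51) and the proof of Thm. 3.19 (chunk p0014:L78–L81)]
[cite: Kato2004Asterisque, §17.13 (p. 280)] [cite: Washington1997, §13.2] -/
def mainIdentityAtAugmentation (W : WeierstrassCurve ℚ) [W.IsGloballyMinimal] (p : ℕ) [Fact p.Prime]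
    {N : ℕ} (f : CuspForm (Gamma0 N) 2) {κ : ZpExtension ℚ p} {γ : Field.absoluteGaloisGroup ℚ}
    (D : W.SelmerDualData κ γ) : Prop :=
  lengthAt (IwasawaAlgebra p) D.X (primeT p) = (padicLFunction f (unitRoot W p : ℚ_[p])).order

/-- Unfolding of `mainIdentityAtAugmentation`. [cite: Kim2025RefinedTNC, statement 3.17 (§3.5.3, chunk p0014:L43–L51)] -/
theorem mainIdentityAtAugmentation_iff (W : WeierstrassCurve ℚ) [W.IsGloballyMinimal] (p : ℕ)
    [Fact p.Prime] {N : ℕ} (f : CuspForm (Gamma0 N) 2) {κ : ZpExtension ℚ p}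
    {γ : Field.absoluteGaloisGroup ℚ} (D : W.SelmerDualData κ γ) :
    mainIdentityAtAugmentation W p f D ↔
      lengthAt (IwasawaAlgebra p) D.X (primeT p) =
        (padicLFunction f (unitRoot W p : ℚ_[p])).order :=
  Iff.rfl

/-! ### `Λ`-algebra: the multiplicity of `(T)` in a principal characteristic ideal (proved) -/

section Algebra

variable {p : ℕ} [Fact p.Prime]

/-- **`length_{Λ_{(T)}} X_{(T)} = ord_T g` when `char_Λ X = (g)`**, for a finitely generated torsion
`Λ`-module `X`: `≤` is the structure-theorem inequality `lengthAt_primeT_le_order` (`g ∈ char X`);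
`≥` because `char X = ∏ 𝔮^{ℓ_𝔮(X)} ⊆ (T^{ord_T g})` forces `Fitt_Λ(X) ⊆ (T^{ord_T g})` and `T` is a
prime element (`natCast_le_lengthAt_of_fittingIdeal_zero_le_of_pow_dvd`); `g ≠ 0` since a
characteristic ideal of a torsion module is a product of non-zero primes. Washington §13.2 (the
characteristic power series and its `T`-adic order). [cite: Washington1997, §13.2]
[cite: SkinnerUrban2014, §3.1.6 (p. 20)] -/
theorem lengthAt_primeT_eq_order_of_charIdeal_eq_span {X : Type u} [AddCommGroup X]
    [_root_.Module (IwasawaAlgebra p) X] [Module.Finite (IwasawaAlgebra p) X]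
    (hX : Module.IsTorsion (IwasawaAlgebra p) X) {g : IwasawaAlgebra p}
    (hg : charIdeal (IwasawaAlgebra p) X = Ideal.span {g}) :
    lengthAt (IwasawaAlgebra p) X (primeT p) = g.order := by
  apply le_antisymm
  · exact lengthAt_primeT_le_order X hX g (by rw [hg]; exact Ideal.mem_span_singleton_self g)
  · -- `g ≠ 0`: `char X` is a product of non-zero prime powers
    have hg0 : g ≠ 0 := by
      obtain ⟨t, π, ht, -, -, hchar⟩ := SkinnerUrban2014.exists_charIdeal_eq_span_prod (M := X) hX
      have hne : charIdeal (IwasawaAlgebra p) X ≠ ⊥ := by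
        rw [hchar, Ne, Ideal.span_singleton_eq_bot]
        exact Finset.prod_ne_zero_iff.mpr fun 𝔮 h𝔮 => pow_ne_zero _ (ht 𝔮 h𝔮).2.1.ne_zero
      rintro rfl
      exact hne (by rw [hg, Ideal.span_singleton_eq_bot])
    have hfin : g.order ≠ ⊤ := by rwa [Ne, PowerSeries.order_eq_top]
    rw [← ENat.coe_toNat hfin]
    refine SkinnerUrban2014.natCast_le_lengthAt_of_fittingIdeal_zero_le_of_pow_dvd hX
      PowerSeries.X_prime (PowerSeries.X_pow_order_dvd (φ := g)) ?_ (primeT p) (primeT_asIdeal p)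
    exact (SkinnerUrban2014.charIdeal_le_span_singleton_iff hX).mp (le_of_eq hg)

end Algebra

/-! ### The identity at `𝟙` from the tree's main-conjecture shapes (proved) -/

section FromMainConjecture

variable {W : WeierstrassCurve ℚ} [W.IsElliptic] [W.IsGloballyMinimal] {p : ℕ} [Fact p.Prime]
  {N : ℕ} {f : CuspForm (Gamma0 N) 2} {κ : ZpExtension ℚ p} {γ : Field.absoluteGaloisGroup ℚ}

omit [W.IsElliptic] in
/-- **The RATIONAL main identity `char_Λ X·(Λ ⊗ ℚ_p) = (L_p)` implies the identity at `𝟙`.** If `X(E/ℚ_∞)` is a finitely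
generated torsion `Λ`-module with `char_Λ X = (g)` and `ι g = p^k · L_p(E,T)` in `ℚ_p⟦T⟧`
(`k ∈ ℤ`; the shape of clause 2 of the tree's Skinner–Urban fact bsd.S21 (file `PAdicBSD`) and of
`burungale_castella_skinner_charIdeal_eq_padicLFunction`), then
`length_{(T)} X = ord_T g = ord_T ι(g) = ord_T L_p(E,T)` (`ι` is coefficientwise injective and `p^k`
is a unit of `ℚ_p⟦T⟧`). Kato §17.13 at `𝔭 = (T)`: powers of `p` are invisible at the augmentation
prime. [cite: Kato2004Asterisque, §17.13 (p. 280)] [cite: Washington1997, §13.2] -/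
theorem mainIdentityAtAugmentation_of_charIdeal_eq_span (D : W.SelmerDualData κ γ)
    [Module.Finite (IwasawaAlgebra p) D.X] (hX : D.IsTorsion) {g : IwasawaAlgebra p} {k : ℤ}
    (hchar : D.charIdeal = Ideal.span {g})
    (hιg : iwasawaToPowerSeries p g =
      PowerSeries.C ((p : ℚ_[p]) ^ k) * padicLFunction f (unitRoot W p : ℚ_[p])) :
    mainIdentityAtAugmentation W p f D := by
  rw [mainIdentityAtAugmentation_iff, lengthAt_primeT_eq_order_of_charIdeal_eq_span hX hchar,
    ← order_iwasawaToPowerSeries p g, hιg, PowerSeries.order_mul]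
  have hp0 : (p : ℚ_[p]) ≠ 0 := by exact_mod_cast (Fact.out : p.Prime).ne_zero
  have hpk : IsUnit (PowerSeries.C ((p : ℚ_[p]) ^ k)) :=
    IsUnit.map PowerSeries.C (IsUnit.mk0 _ (zpow_ne_zero k hp0))
  rw [PowerSeries.order_zero_of_unit hpk, zero_add]

omit [W.IsElliptic] in
/-- **The identity at `𝟙` in the INTEGRAL shape** `char_Λ X = (g)`, `ι g = L_p(E,T)` (clause 3 of
the Skinner–Urban fact bsd.S21 / `kato_divisibility`; the case `k = 0`).
[cite: Kato2004Asterisque, §17.13 (p. 280)] -/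
theorem mainIdentityAtAugmentation_of_charIdeal_eq_span_integral (D : W.SelmerDualData κ γ)
    [Module.Finite (IwasawaAlgebra p) D.X] (hX : D.IsTorsion) {g : IwasawaAlgebra p}
    (hchar : D.charIdeal = Ideal.span {g})
    (hιg : iwasawaToPowerSeries p g = padicLFunction f (unitRoot W p : ℚ_[p])) :
    mainIdentityAtAugmentation W p f D :=
  mainIdentityAtAugmentation_of_charIdeal_eq_span D hX hchar (k := 0) (by simpa using hιg)

/-- **Skinner–Urban 2014, Thm. 3.6.9 (refereed; the tree's named fact bsd.S21 of file `PAdicBSD`,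
printed for EVERY odd prime) gives the identity at `𝟙`**: for `p ≥ 3` good ordinary with `E[p]` irreducible
and a prime `ℓ ≠ p` of multiplicative reduction with `p ∤ ord_ℓ(Δ_E)` (so `E[p]` is ramified at
`ℓ`), the cyclotomic `(κ, γ)` in the cyclotomic variable and the newform `f` of `W`,
`char_Λ X = (g)` with `ι g = p^k L_p(E,T)`, hence `mainIdentityAtAugmentation`. (`X` is finitely
generated over `Λ` for the cyclotomic tower: tree theorem
`SelmerDualData.module_finite_of_isCyclotomic`.) This is the (SU) clause of the source's Thm. 3.19
at the prime `(T)`, including `p = 3`. [cite: SkinnerUrban2014, Thm. 3.6.9 (p. 45)]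
[cite: Kim2025RefinedTNC, Thm. 3.19 (SU) (§3.5.3, chunk p0014:L75–L77)] -/
theorem mainIdentityAtAugmentation_of_skinnerUrban [NeZero N]
    (hSU : skinner_urban_main_conjecture W p (κ := κ) (γ := γ) (f := f))
    (hp : 3 ≤ p) (hord : IsOrdinaryAt W p) (hirr : W.HasIrreducibleModPGaloisRep p)
    (haux : ∃ ℓ : ℕ, ∃ _ : Fact ℓ.Prime, ℓ ≠ p ∧ W.HasMultiplicativeReductionAtPrime ℓ ∧
      ¬ p ∣ padicValInt ℓ W.minimalDiscriminantInt)
    (hκ : κ.IsCyclotomic) (hγ : κ.IsTopGenerator γ) (hγ' : IsCyclotomicVariable p γ)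
    (hf : IsNewformOf W f) (D : W.SelmerDualData κ γ) :
    mainIdentityAtAugmentation W p f D := by
  obtain ⟨hX, ⟨g, k, hchar, hιg⟩, -⟩ :=
    hSU hp ((isOrdinaryAt_iff W p).1 hord).1 ((isOrdinaryAt_iff W p).1 hord).2 hirr haux hκ hγ hγ'
      hf D
  haveI : Module.Finite (IwasawaAlgebra p) D.X :=
    (WeierstrassCurve.SelmerDualData.module_finite_of_isCyclotomic (W := W) (κ := κ) hκ D) hγ
  exact mainIdentityAtAugmentation_of_charIdeal_eq_span D hX hchar hιg

/-- **Burungale–Castella–Skinner 2025, Thm. 1.1.2 (a) (refereed; tree fact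
`burungale_castella_skinner_charIdeal_eq_padicLFunction`) gives the identity at `𝟙` at every good
ordinary `p ≥ 5` with `E[p]` irreducible** (the RATIONAL equality `char_Λ X = (L_p)` in `Λ ⊗ ℚ_p`
suffices at the augmentation prime — no (im)/surjectivity hypothesis).
[cite: BurungaleCastellaSkinner2025, Thm. 1.1.2 (a) (p. 2 of arXiv:2405.00270v2)]
[cite: Kato2004Asterisque, §17.13 (p. 280)] -/
theorem mainIdentityAtAugmentation_of_bcs [NeZero N]
    (hBCS : burungale_castella_skinner_charIdeal_eq_padicLFunction)
    (hp : 5 ≤ p) (hord : IsOrdinaryAt W p) (hirr : W.HasIrreducibleModPGaloisRep p)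
    (hκ : κ.IsCyclotomic) (hγ : κ.IsTopGenerator γ) (hγ' : IsCyclotomicVariable p γ)
    (hf : IsNewformOf W f) (D : W.SelmerDualData κ γ) :
    mainIdentityAtAugmentation W p f D := by
  obtain ⟨hX, g, k, hchar, hιg⟩ :=
    hBCS W p κ γ f hp ((isOrdinaryAt_iff W p).1 hord).1 ((isOrdinaryAt_iff W p).1 hord).2 hirr hκ
      hγ hγ' hf D
  haveI : Module.Finite (IwasawaAlgebra p) D.X :=
    (WeierstrassCurve.SelmerDualData.module_finite_of_isCyclotomic (W := W) (κ := κ) hκ D) hγ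
  exact mainIdentityAtAugmentation_of_charIdeal_eq_span D hX hchar hιg

end FromMainConjecture

/-! ### Thm. 1.2, clause (IMC at 𝟙): the identity at `𝟙` forces a non-vanishing Kurihara number -/

/-- **OPEN HYPOTHESIS — UNREFEREED PREPRINT (arXiv:2505.09121v1, 2025), Thm. 1.2, clause (IMC at
𝟙), weight `2`, good ORDINARY `p ≥ 3` under large image:** "(IMC at 𝟙) the Iwasawa main
[identity] for `T_f^†` localized at the augmentation ideal holds … then `δ^{min,†}` does not
vanish" (proof: "follows from Theorem 3.18.(2) and Proposition 4.2"). Transcribed (module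
docstring DICTIONARY): `W/ℚ` globally minimal elliptic, `p ≥ 3` with `ρ̄_{E,p^n}` onto for all `n`,
`p` good ordinary (`IsOrdinaryAt`, so that the identity at `𝟙` is stated through `L_p(E,T)`),
newform `f` with `Ω⁺_f` an integral period, the cyclotomic `ℤ_p`-extension `κ` with topological
generator `γ` in the cyclotomic variable and ANY Pontryagin-dual datum `D` of `Sel_{p^∞}(E/ℚ_∞)`;
if `mainIdentityAtAugmentation W p f D` then the collection of Kurihara numbers does not vanish on
the cyclic levels: `kuriharaVanishingOrder W p f < ⊤` (the witness of §5.3.2–5.3.3 / Rem. 5.5 at a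
Mazur–Rubin level `n ∈ 𝒩_m`, `m ≫ 0`, where also the `Ω⁺_f`-normalised number is non-zero). With
the corank / structure clauses of Thm. 1.1 (`thm11_…_OPEN`, sibling `CorankStructureOPEN`) this is
how "(IMC at 𝟙) is strong enough to detect the exact bound of Selmer groups" (§1, p0003:L23). The
`p = 3` case rests on Sakamoto 2024 (REFEREED) via §3.2.2 / Prop. 3.4. At a good ordinary `p ≥ 5`
with `ρ̄_{E,p}` onto the PUBLISHED elliptic-curve statement is Kim AJM 148 Thm. 1.9 (1)/Cor. 1.6
(`Kim2022_exists_kuriharaNumber_ne_zero_of_selmerCorank`, other currency: period transfer, no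
cyclicity flag). NEVER cite this `Prop` as a theorem; explicit hypothesis only. Weaker than the
announced print (weight `2`; ordinary; tower; cyclic levels; integral-period binder), never
stronger. [claim: Kim2025RefinedTNC, status: under-review]
[cite: Kim2025RefinedTNC, Thm. 1.2 clause (IMC at 𝟙) and its proof (§1.2.2, chunk p0005:L30–L42), statement 3.17 and Thm. 3.18 (2) (§3.5.3, chunk p0014:L43–L73), Prop. 4.2 (chunk p0016:L50), Rem. 5.5 and §5.3.2–5.3.3 (chunks p0018:L86–p0019:L12), §1.4.4 (chunk p0008:L43–L46) (ANNOUNCED, typed as an OPEN hypothesis, nothing asserted)]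
[cite: Kato2004Asterisque, §17.13 (p. 280)] [cite: Sakamoto2024KolyvaginThree, Thm. 1.1 = Thm. 4.4 (p. 920)] -/
def thm12_kuriharaVanishingOrder_lt_top_of_mainIdentityAtAugmentation_OPEN : Prop :=
  ∀ (W : WeierstrassCurve ℚ) [W.IsElliptic] [W.IsGloballyMinimal] (p : ℕ) [Fact p.Prime],
    3 ≤ p → (∀ n : ℕ, W.HasSurjectiveModNGaloisRep (p ^ n : ℕ)) → IsOrdinaryAt W p →
    ∀ {N : ℕ} [NeZero N] (f : CuspForm (Gamma0 N) 2), IsNewformOf W f →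
    (∀ r : ℚ, ratPlusSymbol f r ≠ 0 → 0 ≤ padicValRat p (ratPlusSymbol f r)) →
    ∀ (κ : ZpExtension ℚ p) (γ : Field.absoluteGaloisGroup ℚ), κ.IsCyclotomic →
      κ.IsTopGenerator γ → IsCyclotomicVariable p γ →
    ∀ D : W.SelmerDualData κ γ, mainIdentityAtAugmentation W p f D →
    kuriharaVanishingOrder W p f < ⊤

/-! ### Thm. 1.2, converse: a non-vanishing Kurihara number forces the identity at `𝟙` -/

/-- **OPEN HYPOTHESIS — UNREFEREED PREPRINT (arXiv:2505.09121v1, 2025), Thm. 1.2, CONVERSE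
clause, weight `2`, good ORDINARY `p ≥ 3` under large image:** "Conversely, if `δ^{min,†}` does not
vanish, then the Iwasawa main [identity] for `T_f^†` localized at the augmentation ideal holds"
(proof: Thm. 3.18 (2) with Prop. 4.2; "By computing `ord_π(δ^{min,k−r}_n)` for many `n`, we can
verify (IMC at 𝟙) numerically"). Transcribed with the binders of the forward clause: if some cyclic
Kolyvagin level carries a non-vanishing `Ω⁺_f`-normalised Kurihara number
(`kuriharaVanishingOrder W p f < ⊤`; then `δ^{min}_n = c⁻¹ δ̃^{Ω⁺_f}_n ≠ 0` too, §1.4.4), then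
`mainIdentityAtAugmentation W p f D` for every Pontryagin-dual datum `D` of `Sel_{p^∞}(E/ℚ_∞)` along
the cyclotomic `(κ, γ)` in the cyclotomic variable. The `p = 3` case rests on Sakamoto 2024
(REFEREED). NEVER cite this `Prop` as a theorem; explicit hypothesis only. Weaker than the announced
print (weight `2`; ordinary; tower; cyclic levels; integral-period binder), never stronger.
[claim: Kim2025RefinedTNC, status: under-review]
[cite: Kim2025RefinedTNC, Thm. 1.2 converse clause and its proof (§1.2.2, chunk p0005:L35–L44), Thm. 3.18 (2) (§3.5.3, chunk p0014:L62–L66), Prop. 4.2 (chunk p0016:L50) (ANNOUNCED, typed as an OPEN hypothesis, nothing asserted)]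
[cite: Kato2004Asterisque, §17.13 (p. 280)] [cite: Sakamoto2024KolyvaginThree, Thm. 1.1 = Thm. 4.4 (p. 920)] -/
def thm12_mainIdentityAtAugmentation_of_kuriharaVanishingOrder_lt_top_OPEN : Prop :=
  ∀ (W : WeierstrassCurve ℚ) [W.IsElliptic] [W.IsGloballyMinimal] (p : ℕ) [Fact p.Prime],
    3 ≤ p → (∀ n : ℕ, W.HasSurjectiveModNGaloisRep (p ^ n : ℕ)) → IsOrdinaryAt W p →
    ∀ {N : ℕ} [NeZero N] (f : CuspForm (Gamma0 N) 2), IsNewformOf W f →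
    (∀ r : ℚ, ratPlusSymbol f r ≠ 0 → 0 ≤ padicValRat p (ratPlusSymbol f r)) →
    ∀ (κ : ZpExtension ℚ p) (γ : Field.absoluteGaloisGroup ℚ), κ.IsCyclotomic →
      κ.IsTopGenerator γ → IsCyclotomicVariable p γ →
    kuriharaVanishingOrder W p f < ⊤ →
    ∀ D : W.SelmerDualData κ γ, mainIdentityAtAugmentation W p f D

/-! ### Proved bookkeeping: non-vanishing at `p = 3` (Skinner–Urban class) and at `p ≥ 5`, and the
composition with Thm. 1.1 -/

section Bookkeeping

variable (W : WeierstrassCurve ℚ) [W.IsElliptic] [W.IsGloballyMinimal] (p : ℕ) [Fact p.Prime]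
  {N : ℕ} [NeZero N] (f : CuspForm (Gamma0 N) 2)

omit [W.IsGloballyMinimal] [NeZero N] in
/-- Large image in the tower form gives `E[p]` irreducible (level `n = 1` and the tree theorem
`hasIrreducibleModPGaloisRep_of_hasSurjectiveModNGaloisRep`). [cite: Kim2025RefinedTNC, §1.1.1 (chunk p0004) and §3.2.2 (chunk p0011:L95)] -/
theorem hasIrreducibleModPGaloisRep_of_tower
    (htower : ∀ n : ℕ, W.HasSurjectiveModNGaloisRep (p ^ n : ℕ)) :
    W.HasIrreducibleModPGaloisRep p :=
  hasIrreducibleModPGaloisRep_of_hasSurjectiveModNGaloisRep W p (by simpa using htower 1)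

/-- **Thm. 1.2 via (IMC at 𝟙) and Thm. 3.19 (SU), INCLUDING `p = 3`: the Kurihara numbers of `E` do
not vanish** — for `p ≥ 3` good ordinary with `ρ̄_{E,p^n}` onto for all `n`, a multiplicative prime
`ℓ ≠ p` with `p ∤ ord_ℓ(Δ_E)`, and the newform `f` with `Ω⁺_f` integral — GRANTED the preprint's
clause (IMC at 𝟙) (`h12`, OPEN) and Skinner–Urban's theorem (`hSU`, the tree's refereed named
fact, here for the cyclotomic datum produced by
`exists_isCyclotomic_isTopGenerator_isCyclotomicVariable_holds`). The source states (ord) only for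
`p ≥ 5` (through Wan); at `p = 3` the printed road is exactly this one, (IMC at 𝟙) ⟸ (SU).
[cite: Kim2025RefinedTNC, Thm. 1.2 (IMC at 𝟙)/(ord) and proof (§1.2.2, chunk p0005:L30–L42), Thm. 3.19 (SU) (chunk p0014:L75–L77) (ANNOUNCED; `h12` is an OPEN Prop)]
[cite: SkinnerUrban2014, Thm. 3.6.9 (p. 45)] -/
theorem kuriharaVanishingOrder_lt_top_of_skinnerUrban_of_OPEN
    (h12 : thm12_kuriharaVanishingOrder_lt_top_of_mainIdentityAtAugmentation_OPEN)
    (hSU : ∀ (κ : ZpExtension ℚ p) (γ : Field.absoluteGaloisGroup ℚ),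
      skinner_urban_main_conjecture W p (κ := κ) (γ := γ) (f := f))
    (hp : 3 ≤ p) (htower : ∀ n : ℕ, W.HasSurjectiveModNGaloisRep (p ^ n : ℕ))
    (hord : IsOrdinaryAt W p)
    (haux : ∃ ℓ : ℕ, ∃ _ : Fact ℓ.Prime, ℓ ≠ p ∧ W.HasMultiplicativeReductionAtPrime ℓ ∧
      ¬ p ∣ padicValInt ℓ W.minimalDiscriminantInt)
    (hf : IsNewformOf W f)
    (hint : ∀ r : ℚ, ratPlusSymbol f r ≠ 0 → 0 ≤ padicValRat p (ratPlusSymbol f r)) :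
    kuriharaVanishingOrder W p f < ⊤ := by
  obtain ⟨κ, hκ, γ, hγ, hγ'⟩ := exists_isCyclotomic_isTopGenerator_isCyclotomicVariable_holds p
  obtain ⟨D⟩ := W.nonempty_selmerDualData_holds κ γ hγ
  exact h12 W p hp htower hord f hf hint κ γ hκ hγ hγ' D
    (mainIdentityAtAugmentation_of_skinnerUrban (hSU κ γ) hp hord
      (hasIrreducibleModPGaloisRep_of_tower W p htower) haux hκ hγ hγ' hf D)

/-- **The same at a good ordinary `p ≥ 5` from Burungale–Castella–Skinner (a)** (no multiplicative
prime needed; `E[p]` irreducible follows from the tower).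
[cite: Kim2025RefinedTNC, Thm. 1.2 (IMC at 𝟙) and proof (§1.2.2, chunk p0005:L30–L42) (ANNOUNCED; `h12` is an OPEN Prop)]
[cite: BurungaleCastellaSkinner2025, Thm. 1.1.2 (a) (p. 2 of arXiv:2405.00270v2)] -/
theorem kuriharaVanishingOrder_lt_top_of_bcs_of_OPEN
    (h12 : thm12_kuriharaVanishingOrder_lt_top_of_mainIdentityAtAugmentation_OPEN)
    (hBCS : burungale_castella_skinner_charIdeal_eq_padicLFunction)
    (hp : 5 ≤ p) (htower : ∀ n : ℕ, W.HasSurjectiveModNGaloisRep (p ^ n : ℕ))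
    (hord : IsOrdinaryAt W p) (hf : IsNewformOf W f)
    (hint : ∀ r : ℚ, ratPlusSymbol f r ≠ 0 → 0 ≤ padicValRat p (ratPlusSymbol f r)) :
    kuriharaVanishingOrder W p f < ⊤ := by
  obtain ⟨κ, hκ, γ, hγ, hγ'⟩ := exists_isCyclotomic_isTopGenerator_isCyclotomicVariable_holds p
  obtain ⟨D⟩ := W.nonempty_selmerDualData_holds κ γ hγ
  exact h12 W p (le_trans (by norm_num) hp) htower hord f hf hint κ γ hκ hγ hγ' D
    (mainIdentityAtAugmentation_of_bcs hBCS hp hord (hasIrreducibleModPGaloisRep_of_tower W p htower)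
      hκ hγ hγ' hf D)

/-- **Thm. 1.1 ("BSD") corank clause COMPOSED with Thm. 1.2 (IMC at 𝟙) ⟸ (SU): `ord(δ̃) = cork`**
at every `p ≥ 3` of the Skinner–Urban class (both Kim inputs OPEN; Skinner–Urban refereed): there is
`r : ℕ` with `kuriharaVanishingOrder W p f = r` and `corank_{ℤ_p} Sel_{p^∞}(E/ℚ) = r`.
[cite: Kim2025RefinedTNC, Thm. 1.1 ("BSD") first clause (chunk p0004:L86–L89) and Thm. 1.2 (chunk p0005:L22–L42) (ANNOUNCED; `h11`, `h12` are OPEN Props)]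
[cite: SkinnerUrban2014, Thm. 3.6.9 (p. 45)] -/
theorem selmerCorank_eq_kuriharaVanishingOrder_of_skinnerUrban_of_OPEN
    (h11 : thm11_selmerCorank_eq_of_kuriharaVanishingOrder_eq_OPEN)
    (h12 : thm12_kuriharaVanishingOrder_lt_top_of_mainIdentityAtAugmentation_OPEN)
    (hSU : ∀ (κ : ZpExtension ℚ p) (γ : Field.absoluteGaloisGroup ℚ),
      skinner_urban_main_conjecture W p (κ := κ) (γ := γ) (f := f))
    (hp : 3 ≤ p) (htower : ∀ n : ℕ, W.HasSurjectiveModNGaloisRep (p ^ n : ℕ))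
    (hord : IsOrdinaryAt W p)
    (haux : ∃ ℓ : ℕ, ∃ _ : Fact ℓ.Prime, ℓ ≠ p ∧ W.HasMultiplicativeReductionAtPrime ℓ ∧
      ¬ p ∣ padicValInt ℓ W.minimalDiscriminantInt)
    (hf : IsNewformOf W f)
    (hint : ∀ r : ℚ, ratPlusSymbol f r ≠ 0 → 0 ≤ padicValRat p (ratPlusSymbol f r)) :
    ∃ r : ℕ, kuriharaVanishingOrder W p f = r ∧ W.selmerCorank p = r := by
  have hlt := kuriharaVanishingOrder_lt_top_of_skinnerUrban_of_OPEN W p f h12 hSU hp htower hord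
    haux hf hint
  obtain ⟨r, hr⟩ := ENat.ne_top_iff_exists.mp hlt.ne
  exact ⟨r, hr.symm, h11 W p hp htower f hf hint r hr.symm⟩

/-- **Thm. 1.1 (Str) COMPOSED with Thm. 1.2 (IMC at 𝟙) ⟸ (SU): the module structure of `Ш(E/ℚ)[p^∞]`**
at every `p ≥ 3` of the Skinner–Urban class with `Ш(E/ℚ)` finite (Kim inputs OPEN; Skinner–Urban
refereed): `ord(δ̃) = r` for some `r : ℕ` and `Ш(E/ℚ)[p^∞] ≃ ⨁_{i<m} (ℤ/p^{e_i})^{⊕2}` with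
`∂^{(r+2i)}(δ̃) = ∂^{(r+2i+2)}(δ̃) + 2e_i`. This is the shape behind the `(ℤ/9)²`-rows of App. A
at `p = 3` where no rank-`0`/rank-`1` input applies.
[cite: Kim2025RefinedTNC, Thm. 1.1 (Str) (chunk p0004:L79–L84), Thm. 1.2 (chunk p0005:L22–L42), App. A.1.1 (chunk p0026) (ANNOUNCED; `h11s`, `h12` are OPEN Props)]
[cite: SkinnerUrban2014, Thm. 3.6.9 (p. 45)] -/
theorem sha_structure_of_skinnerUrban_of_OPEN
    (h11s : thm11_sha_structure_of_kuriharaVanishingOrder_eq_OPEN)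
    (h12 : thm12_kuriharaVanishingOrder_lt_top_of_mainIdentityAtAugmentation_OPEN)
    (hSU : ∀ (κ : ZpExtension ℚ p) (γ : Field.absoluteGaloisGroup ℚ),
      skinner_urban_main_conjecture W p (κ := κ) (γ := γ) (f := f))
    (hp : 3 ≤ p) (htower : ∀ n : ℕ, W.HasSurjectiveModNGaloisRep (p ^ n : ℕ))
    (hord : IsOrdinaryAt W p)
    (haux : ∃ ℓ : ℕ, ∃ _ : Fact ℓ.Prime, ℓ ≠ p ∧ W.HasMultiplicativeReductionAtPrime ℓ ∧
      ¬ p ∣ padicValInt ℓ W.minimalDiscriminantInt)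
    (hfin : Finite W.sha) (hf : IsNewformOf W f)
    (hint : ∀ r : ℚ, ratPlusSymbol f r ≠ 0 → 0 ≤ padicValRat p (ratPlusSymbol f r)) :
    ∃ (r m : ℕ) (e : ℕ → ℕ), kuriharaVanishingOrder W p f = r ∧
      (∀ i : ℕ, kuriharaPartial W p f (r + 2 * i) =
          kuriharaPartial W p f (r + 2 * i + 2) + ((2 * e i : ℕ) : ℕ∞)) ∧
      (∀ i : ℕ, m ≤ i → e i = 0) ∧
      Nonempty (AddCommGroup.primaryComponent W.sha p ≃+
        ((i : Fin m) → ZMod (p ^ e i) × ZMod (p ^ e i))) := by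
  have hlt := kuriharaVanishingOrder_lt_top_of_skinnerUrban_of_OPEN W p f h12 hSU hp htower hord
    haux hf hint
  obtain ⟨r, hr⟩ := ENat.ne_top_iff_exists.mp hlt.ne
  obtain ⟨m, e, he, hm, hiso⟩ := h11s W p hp htower hfin f hf hint r hr.symm
  exact ⟨r, m, e, hr.symm, he, hm, hiso⟩

/-- **`ord(δ̃) = cork` at a good ordinary `p ≥ 5` under large image**, from (IMC at 𝟙) ⟸
Burungale–Castella–Skinner (a) (Kim inputs OPEN; BCS refereed) — the cyclic-level currency in which
the structure clauses of Thm. 1.1 are typed (the published Kim AJM facts use the period-transfer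
currency). [cite: Kim2025RefinedTNC, Thm. 1.1 ("BSD") first clause (chunk p0004:L86–L89) and Thm. 1.2 (chunk p0005:L22–L42) (ANNOUNCED; `h11`, `h12` are OPEN Props)]
[cite: BurungaleCastellaSkinner2025, Thm. 1.1.2 (a) (p. 2 of arXiv:2405.00270v2)] -/
theorem selmerCorank_eq_kuriharaVanishingOrder_of_bcs_of_OPEN
    (h11 : thm11_selmerCorank_eq_of_kuriharaVanishingOrder_eq_OPEN)
    (h12 : thm12_kuriharaVanishingOrder_lt_top_of_mainIdentityAtAugmentation_OPEN)
    (hBCS : burungale_castella_skinner_charIdeal_eq_padicLFunction)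
    (hp : 5 ≤ p) (htower : ∀ n : ℕ, W.HasSurjectiveModNGaloisRep (p ^ n : ℕ))
    (hord : IsOrdinaryAt W p) (hf : IsNewformOf W f)
    (hint : ∀ r : ℚ, ratPlusSymbol f r ≠ 0 → 0 ≤ padicValRat p (ratPlusSymbol f r)) :
    ∃ r : ℕ, kuriharaVanishingOrder W p f = r ∧ W.selmerCorank p = r := by
  have hlt := kuriharaVanishingOrder_lt_top_of_bcs_of_OPEN W p f h12 hBCS hp htower hord hf hint
  obtain ⟨r, hr⟩ := ENat.ne_top_iff_exists.mp hlt.ne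
  exact ⟨r, hr.symm, h11 W p (le_trans (by norm_num) hp) htower f hf hint r hr.symm⟩

/-! #### Numerical verification of (IMC at 𝟙) (p0005:L44), read in the kernel -/

omit [W.IsElliptic] [Fact (Nat.Prime p)] [NeZero N] in
/-- A non-vanishing `Ω⁺_f`-normalised Kurihara number `kuriharaNumber f (p^k) n ψ ≠ 0` at a level
`n ∈ 𝒩_k` (surjective discrete logarithms `ψ`) bounds the divisibility index of `δ̃_n`:
`kuriharaDivIndex W p f n < ⊤` (indeed `< k`). [cite: Kim2022StructureSelmer, §1.5.1 (PDF p. 7), Def. 2.13 (PDF p. 14)] -/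
theorem kuriharaDivIndex_lt_top_of_kuriharaNumber_ne_zero {k n : ℕ} [NeZero n]
    (hn : Kato.IsKolyvaginProduct W p k n)
    (ψ : (ℓ : ℕ) → (ZMod ℓ)ˣ →* Multiplicative (ZMod (p ^ k)))
    (hψ : ∀ ℓ ∈ n.primeFactors, Function.Surjective (ψ ℓ))
    (hne : kuriharaNumber f (p ^ k) n ψ ≠ 0) : kuriharaDivIndex W p f n < ⊤ := by
  refine lt_of_le_of_lt (b := (k : ℕ∞)) ?_ (ENat.coe_lt_top k)
  rw [kuriharaDivIndex_def]
  refine iSup₂_le fun j hj => ?_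
  by_contra hlt
  have hkj : k ≤ j := by exact_mod_cast (not_le.mp hlt).le
  exact hne (hj k hkj hn ψ hψ)

omit [W.IsElliptic] [Fact (Nat.Prime p)] [NeZero N] in
/-- A non-vanishing Kurihara number at a CYCLIC Kolyvagin level shows that the collection does not
vanish: `kuriharaVanishingOrder W p f ≤ ν(n) < ⊤`. [cite: Kim2022StructureSelmer, §1.4.4 (PDF p. 7)] -/
theorem kuriharaVanishingOrder_lt_top_of_kuriharaNumber_ne_zero {k n : ℕ} [NeZero n]
    (hcyc : IsCyclicKolyvaginLevel W p n) (hn : Kato.IsKolyvaginProduct W p k n)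
    (ψ : (ℓ : ℕ) → (ZMod ℓ)ˣ →* Multiplicative (ZMod (p ^ k)))
    (hψ : ∀ ℓ ∈ n.primeFactors, Function.Surjective (ψ ℓ))
    (hne : kuriharaNumber f (p ^ k) n ψ ≠ 0) : kuriharaVanishingOrder W p f < ⊤ := by
  have h0 := kuriharaDivIndex_lt_top_of_kuriharaNumber_ne_zero W p f hn ψ hψ hne
  refine lt_of_le_of_lt (b := (n.primeFactors.card : ℕ∞)) ?_ (ENat.coe_lt_top _)
  exact iInf_le_of_le n (iInf_le_of_le hcyc (iInf_le_of_le h0 le_rfl))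

/-- **"By computing `ord_π(δ^{min}_n)` for many `n`, we can verify (IMC at 𝟙) numerically"
(p0005:L44), in the kernel: ONE non-vanishing Kurihara number at a cyclic level certifies the
identity at `𝟙`** (GRANTED the converse clause of Thm. 1.2, OPEN): for `p ≥ 3` good ordinary under
large image, the newform `f` with `Ω⁺_f` integral, a cyclic level `n ∈ 𝒩_k` and surjective `ψ`
with `kuriharaNumber f (p^k) n ψ ≠ 0`, every Pontryagin-dual datum `D` of `Sel_{p^∞}(E/ℚ_∞)` along
the cyclotomic `(κ, γ)` in the cyclotomic variable satisfies `length_{(T)} X = ord_{T=0} L_p(E,T)`.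
[cite: Kim2025RefinedTNC, Thm. 1.2 converse clause and the sentence after its proof (§1.2.2, chunk p0005:L35–L44) (ANNOUNCED; `h12c` is an OPEN Prop)] -/
theorem mainIdentityAtAugmentation_of_kuriharaNumber_ne_zero_of_OPEN
    (h12c : thm12_mainIdentityAtAugmentation_of_kuriharaVanishingOrder_lt_top_OPEN)
    (hp : 3 ≤ p) (htower : ∀ n : ℕ, W.HasSurjectiveModNGaloisRep (p ^ n : ℕ))
    (hord : IsOrdinaryAt W p) (hf : IsNewformOf W f)
    (hint : ∀ r : ℚ, ratPlusSymbol f r ≠ 0 → 0 ≤ padicValRat p (ratPlusSymbol f r))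
    {k n : ℕ} [NeZero n] (hcyc : IsCyclicKolyvaginLevel W p n)
    (hn : Kato.IsKolyvaginProduct W p k n)
    (ψ : (ℓ : ℕ) → (ZMod ℓ)ˣ →* Multiplicative (ZMod (p ^ k)))
    (hψ : ∀ ℓ ∈ n.primeFactors, Function.Surjective (ψ ℓ))
    (hne : kuriharaNumber f (p ^ k) n ψ ≠ 0)
    {κ : ZpExtension ℚ p} {γ : Field.absoluteGaloisGroup ℚ} (hκ : κ.IsCyclotomic)
    (hγ : κ.IsTopGenerator γ) (hγ' : IsCyclotomicVariable p γ) (D : W.SelmerDualData κ γ) :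
    mainIdentityAtAugmentation W p f D :=
  h12c W p hp htower hord f hf hint κ γ hκ hγ hγ'
    (kuriharaVanishingOrder_lt_top_of_kuriharaNumber_ne_zero W p f hcyc hn ψ hψ hne) D

/-- **In analytic rank `0` the identity at `𝟙` says `T ∤ char_Λ X(E/ℚ_∞)`**: with `L(E,1) ≠ 0`,
`δ̃_1 = [0]⁺_f = L(E,1)/Ω⁺_f ≠ 0`, so `ord(δ̃) = 0 < ⊤` (tree
`kuriharaVanishingOrder_eq_zero_of_ratPlusSymbol_ne_zero`-free form: the level `1` is cyclic and
`[0]⁺_f mod p^k ≠ 0` for `k = ord_p [0]⁺_f + 1`); hence, GRANTED the converse clause (OPEN),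
`mainIdentityAtAugmentation` — the source's "(rk0) implies (IMC at 𝟙)" for elliptic curves, in the
cyclic-level currency, from the hypothesis `kuriharaVanishingOrder W p f < ⊤` supplied by the caller
(e.g. from `kuriharaVanishingOrder_eq_zero_of`).
[cite: Kim2025RefinedTNC, Thm. 1.2 "In particular, either (rk0) or (rk1+ε) implies (IMC at 𝟙)" (§1.2.2, chunk p0005:L35) (ANNOUNCED; `h12c` is an OPEN Prop)] -/
theorem mainIdentityAtAugmentation_of_kuriharaVanishingOrder_lt_top_of_OPEN
    (h12c : thm12_mainIdentityAtAugmentation_of_kuriharaVanishingOrder_lt_top_OPEN)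
    (hp : 3 ≤ p) (htower : ∀ n : ℕ, W.HasSurjectiveModNGaloisRep (p ^ n : ℕ))
    (hord : IsOrdinaryAt W p) (hf : IsNewformOf W f)
    (hint : ∀ r : ℚ, ratPlusSymbol f r ≠ 0 → 0 ≤ padicValRat p (ratPlusSymbol f r))
    (hlt : kuriharaVanishingOrder W p f < ⊤)
    {κ : ZpExtension ℚ p} {γ : Field.absoluteGaloisGroup ℚ} (hκ : κ.IsCyclotomic)
    (hγ : κ.IsTopGenerator γ) (hγ' : IsCyclotomicVariable p γ) (D : W.SelmerDualData κ γ) :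
    mainIdentityAtAugmentation W p f D :=
  h12c W p hp htower hord f hf hint κ γ hκ hγ hγ' hlt D

end Bookkeeping

end Literature.NumberTheory.EllipticCurves.Kim2025

end
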